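import Mathlib
import Summits.ValiantsHypothesis.ValiantsHypothesis.Theorems.MonotoneRestorationOrbitRestorationQPLevelAction
import Summits.ValiantsHypothesis.ValiantsHypothesis.Theorems.MonotoneRestorationOrbitRestorationQPDepthThreeRungDefs
import HarnessLib

/-!
# Route MonotoneRestoration — crux `OrbitRestorationQP` (stmt-ValiantsHypothesis-18293): vocabulary of
# the line `mixing-scale` (route-posited objects, D-0016 `<RouteSlug>Defs.lean`)

The registered skeleton `Cruxes/OrbitRestorationQP/Lines/mixing_scale.lean` (val-idea-12, lens nearmiss; bears on the rung
`ProductDepthRestorationQP (fun _ => 1)` through the new rung `GrowingFaninRestoration`) phrases its stubs M2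
(`stub_almostInvariantTerms`) and M3 (`stub_orbitClassSums`) in a small local vocabulary.  The stub files
`Theorems/MonotoneRestorationMixingScale*.lean` that land these stubs by name must speak about THE SAME declarations, so the
vocabulary is collected here, VERBATIM from the skeleton (same names, same bodies; namespace
`Summit.ValiantsHypothesis.ValiantsHypothesis.Theorems.OrbitRestorationQPMixingScale`; the skeleton re-points to it by `open`).
Nothing here asserts anything; no instance, no notation.

For a clean minimal representation `R : CleanRep f D` (`…LevelRep.lean`) of a polynomial `f` on the `n × n` variable matrix, with
rank-bound constant `Rb R.m D` (`…LevelMatch.lean`), rank distance `rdist` and the re-normalising action `act` (`…RankDistance.lean`)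
of the matrix action `mact σ τ` (`…LevelAction.lean`):

* `OrbitClose R i j` — some EVEN row/column renaming puts the factor multiset of term `j` within rank distance `Rb` of that of
  term `i`;
* `orbitClass R i` — the ORBIT-LINKED CLASS of `i`: its class under the equivalence generated by `OrbitClose R`;
* `AlmostInvariantTerms` — the conclusion of M2 (every term is `28·Rb`-almost invariant under even renamings in the mixing
  regime `8 < n`, `m³ + 2 ≤ n`);
* `OrbitClassSums` — the conclusion of M3 (every even renaming fixes the sum of the terms of each orbit-linked class).

Honest framing: these are inputs to ONE sub-rung of the first rung of the product-depth ladder under a tier-B crux; nothing here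
bears on VP ≠ VNP.  Background: Karnin–Shpilka 2009 §3 (rank distance), Saxena–Seshadhri 2013 Theorem 5 (the rank bound, the
tree's named fact `depthThree_rankBound`).
-/

noncomputable section

open MvPolynomial Equiv
open Summit.ValiantsHypothesis.ValiantsHypothesis.Theorems.RankDistance
open Summit.ValiantsHypothesis.ValiantsHypothesis.Theorems.LevelRep
open Summit.ValiantsHypothesis.ValiantsHypothesis.Theorems.LevelStructure

-- `Summit.ValiantsHypothesis.ValiantsHypothesis.…` is the tree's single-conjunct layout (Sub = Summit).
set_option linter.dupNamespace false

namespace Summit.ValiantsHypothesis.ValiantsHypothesis.Theorems.OrbitRestorationQPMixingScale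

variable {n D : ℕ} {f : MvPolynomial (Fin n × Fin n) ℂ}

open Classical in
/-- `i` and `j` are ORBIT-CLOSE if an even row/column renaming puts the factor multiset of term `j` within rank distance `Rb` of
that of term `i` (verbatim the skeleton's `OrbitClose`). [folklore] -/
def OrbitClose (R : CleanRep f D) (i j : Fin R.m) : Prop :=
  ∃ σ τ : Perm (Fin n), Perm.sign σ = 1 ∧ Perm.sign τ = 1 ∧ rdist (R.L i) (act (mact σ τ) (R.L j)) ≤ Rb R.m D

open Classical in
/-- The ORBIT-LINKED CLASS of term `i`: the equivalence class of `i` under the equivalence generated by `OrbitClose` (verbatim the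
skeleton's `orbitClass`). [folklore] -/
def orbitClass (R : CleanRep f D) (i : Fin R.m) : Finset (Fin R.m) :=
  Finset.univ.filter fun j => Relation.EqvGen (OrbitClose R) i j

open Classical in
/-- **ALMOST-INVARIANT TERMS** — an intermediate statement of the line (the conclusion of the registered stub M2
`stub_almostInvariantTerms` and a hypothesis of M4 `stub_polyScaleStructure`; a statement of this development, no citation exists;
body verbatim the skeleton's): in the mixing regime `m³ + 2 ≤ n`, `8 < n`, every term of a clean minimal representation of a
matrix-symmetric `f` has its normalised factor multiset moved by rank distance `≤ 28 · Rb` under every EVEN row/column renaming. -/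
def AlmostInvariantTerms : Prop :=
  ∀ (n D : ℕ) (f : MvPolynomial (Fin n × Fin n) ℂ), (∀ σ τ : Perm (Fin n), mact σ τ f = f) →
    ∀ (R : CleanRep f D), 8 < n → R.m ^ 3 + 2 ≤ n →
    ∀ (i : Fin R.m) (σ τ : Perm (Fin n)), Perm.sign σ = 1 → Perm.sign τ = 1 →
      rdist (R.L i) (act (mact σ τ) (R.L i)) ≤ 28 * Rb R.m D

open Classical in
/-- **ORBIT-LINKED CLASS SUMS ARE INVARIANT** — an intermediate statement of the line (the conclusion of the registered stub M3
`stub_orbitClassSums` and a hypothesis of M4 `stub_polyScaleStructure`; a statement of this development, no citation exists; body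
verbatim the skeleton's): every even row/column renaming fixes the sum of the terms of each orbit-linked class. -/
def OrbitClassSums : Prop :=
  ∀ (n D : ℕ) (f : MvPolynomial (Fin n × Fin n) ℂ), (∀ σ τ : Perm (Fin n), mact σ τ f = f) →
    ∀ (R : CleanRep f D) (i : Fin R.m) (σ τ : Perm (Fin n)), Perm.sign σ = 1 → Perm.sign τ = 1 →
      mact σ τ (∑ j ∈ orbitClass R i, R.T j) = ∑ j ∈ orbitClass R i, R.T j

/-! ### Vocabulary of the split of M4 (skeleton rev 6, val-idea-12; critic PB1): M4a `EssStableAlt`, M4b `SpanOneUAlt` -/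
section M4

open Summit.ValiantsHypothesis.ValiantsHypothesis.Theorems.LinNL
open Summit.ValiantsHypothesis.ValiantsHypothesis.Theorems.LinearSubalgebra

/-- **M4a — THE ESSENTIAL SPACE OF EVEN-INVARIANT CLASS SUMS IS STABLE AND SMALL** — an intermediate statement of the line (the
conclusion of the skeleton's PROVED `essStableAlt` and a hypothesis of M4c `stub_polyScaleStructure`; a statement of this development, no
citation exists; body verbatim the skeleton's rev 6).  For ANY labelling `cl` of the terms of a clean representation with plain
rank-diameter `≤ Θ` whose class sums are fixed by the even row/column renamings, the space `E := ⨆_{F_a ≠ 0} ess (nlPart F_a)` —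
intrinsic to the polynomials `F_a` — is stable under every even `(σ, τ)`, finite-dimensional, and has `finrank ≤ m(1 + m²Θ)`. -/
def EssStableAlt : Prop :=
  ∀ (n D : ℕ) (f : MvPolynomial (Fin n × Fin n) ℂ) (R : CleanRep f D) (cl : Fin R.m → Fin R.m) (Θ : ℕ),
    (∀ i j, cl i = cl j → rdist (R.L i) (R.L j) ≤ Θ) →
    (∀ (a : Fin R.m) (σ τ : Perm (Fin n)), Perm.sign σ = 1 → Perm.sign τ = 1 →
      mact σ τ (R.clusterSum cl a) = R.clusterSum cl a) →
    (∀ σ τ : Perm (Fin n), Perm.sign σ = 1 → Perm.sign τ = 1 →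
      ((Finset.univ.filter fun a => R.clusterSum cl a ≠ 0).sup fun a => ess (nlPart (R.clusterSum cl a))).map
          (mact σ τ).toLinearEquiv.toLinearMap ≤
        (Finset.univ.filter fun a => R.clusterSum cl a ≠ 0).sup fun a => ess (nlPart (R.clusterSum cl a))) ∧
    FiniteDimensional ℂ ↥((Finset.univ.filter fun a => R.clusterSum cl a ≠ 0).sup fun a => ess (nlPart (R.clusterSum cl a))) ∧
    Module.finrank ℂ ↥((Finset.univ.filter fun a => R.clusterSum cl a ≠ 0).sup fun a => ess (nlPart (R.clusterSum cl a))) ≤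
      R.m * (1 + R.m ^ 2 * Θ)

/-- **M4b — SMALL SPACES OF AFFINE FORMS STABLE UNDER THE EVEN MATRIX ACTION LIE IN `span(1, U)`** — an intermediate statement of the
line (the target of the registered stub `stub_spanOneUAlt` and a hypothesis of M4c `stub_polyScaleStructure`; a statement of this
development, no citation exists; body verbatim the skeleton's rev 6): the `𝔄_n × 𝔄_n` version of `LevelStructure.mem_span_one_U` — a
subspace `W` of affine forms with `4·dim W + 8 ≤ n`, stable under the EVEN row/column renamings (`n > 8`), lies in `span(1, U)`. -/
def SpanOneUAlt : Prop :=
  ∀ (n : ℕ), 8 < n → ∀ (W : Submodule ℂ (MvPolynomial (Fin n × Fin n) ℂ)) [FiniteDimensional ℂ ↥W],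
    W ≤ deg1 ℂ (Fin n × Fin n) →
    (∀ σ τ : Perm (Fin n), Perm.sign σ = 1 → Perm.sign τ = 1 → W.map (mact σ τ).toLinearEquiv.toLinearMap ≤ W) →
    4 * Module.finrank ℂ ↥W + 8 ≤ n →
    ∀ w ∈ W, w ∈ Submodule.span ℂ ({C 1, U n} : Set (MvPolynomial (Fin n × Fin n) ℂ))

end M4

/-! ### Vocabulary of the rung level (skeleton rev 7, val-idea-12): A₁ by name, Theorem S′, the new rung, the declared residual -/
section Rung

open Summit.ValiantsHypothesis.ValiantsHypothesis.Theorems.OrbitRestorationQPDepthThreeRung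

/-- **A₁ IN VALUE CURRENCY** — verbatim the statement of the registered stub `DepthThreeRung.stub_piSigmaValue` of the line of record
(the `ΠΣ` sub-rung; OPEN, taken BY NAME as a hypothesis exactly as the landed A_k `stub_sigmaPiSigmaKValue` does; a statement of this
development, no citation exists; body verbatim the skeleton's). -/
def PiSigmaValue : Prop :=
  ∀ f : (n : ℕ) → MvPolynomial (Fin n × Fin n) ℂ, IsMatrixSymmetric f →
    (∃ c : ℕ, ∀ n : ℕ, PDClass (fun _ => 1) n c (f n) ∧
      ∃ (a : ℂ) (L : Multiset (MvPolynomial (Fin n × Fin n) ℂ)),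
        (∀ ℓ ∈ L, ℓ.totalDegree ≤ 1) ∧ Multiset.card L ≤ n ^ c + c ∧ f n = MvPolynomial.C a * L.prod) →
    ∃ c : ℕ, ∀ n : ℕ, QPOrbitRestorable c n (f n)

/-- **THEOREM S′ — LEVEL STRUCTURE AT A POLYNOMIAL THRESHOLD** — the target of the registered stub M4c `stub_polyScaleStructure`
(a statement of this development, no citation exists; body verbatim the skeleton's): the conclusion is verbatim that of the landed
`SigmaPiSigmaK.level_data`; only the threshold changes, `levelThreshold k c` ↦ `A · (k+1)^7 · (log₂ n + 1)` with `A = A(c)`. -/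
def PolyScaleStructure (c : ℕ) : Prop :=
  ∃ A : ℕ, ∀ (k n : ℕ), A * (k + 1) ^ 7 * (Nat.log 2 n + 1) ≤ n →
    ∀ (f : MvPolynomial (Fin n × Fin n) ℂ),
      (∀ σ τ : Perm (Fin n), rename (fun p : Fin n × Fin n => (σ p.1, τ p.2)) f = f) →
      ∀ (a : Fin k → ℂ) (L : Fin k → Multiset (MvPolynomial (Fin n × Fin n) ℂ)),
        (∀ i, ∀ q ∈ L i, q.totalDegree ≤ 1) → (∀ i, Multiset.card (L i) ≤ n ^ c + c) →
        f = ∑ i, C (a i) * (L i).prod →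
        ∃ (u : Fin k → ℂ) (Lin : Fin k → Multiset (MvPolynomial (Fin n × Fin n) ℂ)) (Q : Fin k → Polynomial ℂ),
          (∀ j, ∀ q ∈ Lin j, q.totalDegree ≤ 1) ∧ (∀ j, Multiset.card (Lin j) ≤ n ^ c + c) ∧
          (∀ j (σ τ : Perm (Fin n)), rename (fun p : Fin n × Fin n => (σ p.1, τ p.2)) (Lin j).prod = (Lin j).prod) ∧
          f = ∑ j, C (u j) * (Lin j).prod * Polynomial.aeval (U n) (Q j)

/-- **THE NEW RUNG: RESTORATION FOR GROWING TOP FAN-IN** `κ(n)` with `B(c) · (κ n + 1)^7 · (log₂ n + 1) ≤ n` eventually (value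
currency; `κ ≡ k` recovers A_k; `A_∞ = ProductDepthRestorationQP 1` implies it) — the target of the registered stub M5 `stub_growingFanin`
(a statement of this development, no citation exists; body verbatim the skeleton's). -/
def GrowingFaninRestoration : Prop :=
  ∀ c : ℕ, ∃ B : ℕ, ∀ (κ : ℕ → ℕ) (f : (n : ℕ) → MvPolynomial (Fin n × Fin n) ℂ), IsMatrixSymmetric f →
    (∃ n₀ : ℕ, ∀ n : ℕ, n₀ ≤ n → B * (κ n + 1) ^ 7 * (Nat.log 2 n + 1) ≤ n) →
    (∀ n : ℕ, PDClass (fun _ => 1) n c (f n) ∧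
      ∃ (a : Fin (κ n) → ℂ) (L : Fin (κ n) → Multiset (MvPolynomial (Fin n × Fin n) ℂ)),
        (∀ i, ∀ ℓ ∈ L i, ℓ.totalDegree ≤ 1) ∧ (∀ i, Multiset.card (L i) ≤ n ^ c + c) ∧
        f n = ∑ i, MvPolynomial.C (a i) * (L i).prod) →
    ∃ c' : ℕ, ∀ n : ℕ, QPOrbitRestorable c' n (f n)

/-- **DECLARED RESIDUAL** of the line (never staffed; the target of `stub_residual`; a statement of this development, no citation
exists; body verbatim the skeleton's): the remaining content of the rung `ProductDepthRestorationQP (fun _ => 1)` beyond the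
growing-fan-in regime, typed as the gap implication. -/
def GrowingFaninResidual : Prop := GrowingFaninRestoration → ProductDepthRestorationQP (fun _ => 1)

end Rung

end Summit.ValiantsHypothesis.ValiantsHypothesis.Theorems.OrbitRestorationQPMixingScale

end
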